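import Summits.BirchSwinnertonDyer.BirchSwinnertonDyer.Theorems.PrintX9HeegnerRankOne
import Summits.BirchSwinnertonDyer.Rank1Residual.X9.TwistStability
import Literature.NumberTheory.EllipticCurves.Castella2018.TamagawaQuadraticBaseChangeProofs
import Literature.NumberTheory.EllipticCurves.HeegnerHypothesisKroneckerProofs
import Literature.NumberTheory.EllipticCurves.HeegnerPointsImaginaryQuadraticProofs
import Literature.NumberTheory.EllipticCurves.ModularityVersionApProofs
import Literature.NumberTheory.QuadraticFields.FundamentalDiscriminant
import HarnessLib

/-!
# Class X9: the DISCHARGE INTERFACE for the Heegner TWIN — the twist `E^K` of an X9 pair by a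
# Heegner field `K` with `p` split is again an X9 pair (census predicate included), with the same
# `p`-adic Tamagawa exponent

Print-tier cell `bsd-print-x9` (D-0131 (2), key `x9`), typer seat ty2, file D of the discharge
interface (A = `X9/LeafDischarge`, B = `X10/LeafDischargeX10b`, C = `X9/LeafDischargeHeegner`).
Theorems only: no definition, no new named fact (D-0014 / D-0026). This is the leaf plumbing the
PrintX9 `Assembly` (item stmt-BirchSwinnertonDyer-20394, PLAN.md §2 "frame supply") consumes for the
TWIN `E^K`: the quadratic twist of the X9 curve `E = W` by `d_K = NumberField.discr K`, `K` an
imaginary quadratic field satisfying the Heegner hypothesis for `N_E` (`SatisfiesHeegnerHypothesis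
(W.conductorNorm ℤ) K`: every `ℓ ∣ N_E` splits) and for `p` (`SatisfiesHeegnerHypothesis p K`: `p`
splits), read on a globally minimal model `Wd` (`Cd • W.quadraticTwist (d_K : ℚ) = Wd`, the shape of
the tree's quadratic base-change facts `analyticRankEK_eq_add`, `card_primaryComponent_sha_baseChange…`,
`padicValNat_tamagawaProduct_quadraticTwist_eq`).

What is proved, and from what (all inputs are tree THEOREMS; no fact binder is needed here):

0. `heegnerPrime_not_dvd_discr` — `p` split in `K` ⟹ `p ∤ d_K` (the tree's
   `Literature.SatisfiesHeegnerHypothesis.not_dvd_discr` at level `p`).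
1. `ClassX9.twist_of_heegner` — the twin is an X9 pair in the K6 predicate
   (`Rank1ResidualX9Defs.ClassX9 Wd p`): p4's `classX9_twist_model` (CM by `j`, good ordinary by
   `X11b.goodOrd_twist_model` at `p ∤ 2 d_K`, (irr)/(¬surj) by `E^{(d)}[p] ≅ E[p] ⊗ χ_d`) fed `p ∤ d_K`
   from 0; `ClassX9.padicValNat_torsionOrder_twist_of_heegner` — hence `p ∤ #E^K(ℚ)_tors`.
2. `exists_odd_prime_dvd_discr` — an imaginary quadratic `d_K ∉ {−4, −8}` has an ODD prime factor
   (fundamental discriminants: `d_K ≡ 1 (4)` square-free, or `d_K = 4m`, `m ≡ 2, 3 (4)` square-free;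
   tree `Quadratic.isFundamentalDiscriminant_discr`); `exists_squarefree_twist_of_odd_prime_dvd_discr` —
   for an odd prime `ℓ ∣ d_K`, `W^{(d_K)} ≅ W^{(m)}` over `ℚ` with `m` square-free and `ℓ ∣ m`
   (`m = d_K` or `d_K / 4`; `W^{(4m)} ≅ W^{(m)}` by `exists_variableChange_quadraticTwist_mul_sq`).
3. `not_semistable_twist_of_heegner` — under the Heegner hypothesis for `N_E`, an odd prime
   `ℓ ∣ d_K` does not divide `N_E` (split primes are unramified, `not_dvd_discr`), so `E` has good
   reduction at `ℓ` (`dvd_conductorNorm_iff_not_hasGoodReductionAtPrime`) and the twin — a twist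
   RAMIFIED at `ℓ` — is ADDITIVE at `ℓ` (`X9.addv_of_smul_eq_quadraticTwist_of_dvd`, Silverman *AEC*
   VII.5.1(c)): the twin is NEVER semistable.
4. `ClassX9.twistCensus_of_heegner` — hence the twin satisfies the CENSUS predicate
   `Rank1Residual.ClassX9 Wd p` (whose rank-one clause `r = 1 → ¬ Semistable` holds outright), for
   every Heegner field `K` of `N_E` with `p` split and `d_K ∉ {−4, −8}` (automatic when `|d_K| > 8`,
   `ClassX9.twistCensus_of_heegner_of_eight_lt`): every class-level statement of the cell (corner
   `WAllCornerX9`, crux J `HeegnerDivisibilityX9`, K6 items) applies to the twin BY NAME.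
5. `ClassX9.padicValNat_tamagawaProduct_twist_of_heegner` — `ord_p ∏ c_ℓ(E^K) = ord_p ∏ c_ℓ(E)`
   (`p ≥ 5` from the class; the tree theorem `padicValNat_tamagawaProduct_quadraticTwist_eq` =
   Jetchev–Skinner–Wan 2017 §7.3.1 (eq:tamK), whose bad-prime side condition is vacuous under the
   Heegner hypothesis: every `ℓ ∣ N_E` splits). In particular the Tamagawa depth
   `t = ord_p ∏ c_ℓ` of crux J is the same for `E` and its twin, and the additive primes `ℓ ∣ d_K`
   of the twin (`c_ℓ ≤ 4 < p`) contribute nothing.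

Nothing here is a class theorem and nothing is asserted about any curve; X9 keeps its label.

## References

* [SilvermanAEC2009] VII.5 Prop. 5.1 (reduction type of a twist), X.5 Cor. 5.4 (twists), VIII.8
  Cor. 8.3 (global minimal models).
* [JetchevSkinnerWan2017] §7.3.1 (eq:tamK) (Tamagawa numbers of `E^{(d_K)}` and of `E/K`).
* [GrossLMS1991] §1 (p. 235), [Darmon2004] Hypothesis 3.9 (the Heegner hypothesis: all `ℓ ∣ N` split).
* [Marcus2018] Ch. 2 Thm. 1 (fundamental discriminants of quadratic fields).
-/

set_option autoImplicit false

noncomputable section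

open scoped Classical NumberField

open WeierstrassCurve NumberField Literature.NumberTheory.EllipticCurves
open Literature.NumberTheory.EllipticCurves.Rank1Residual hiding ClassX9
open Summit.BirchSwinnertonDyer.BirchSwinnertonDyer.Rank1Residual
  (classX9_twist_model classX9_of_classX9_census)

namespace Literature.NumberTheory.EllipticCurves.Rank1Residual

/-! ### 0. `p` split in `K` ⟹ `p ∤ d_K` -/

/-- **A prime split in `K` does not divide `d_K`** (split primes are unramified): the Heegner
hypothesis at level `p` for a quadratic field `K` gives `p ∤ NumberField.discr K` — the binder
`hpd` of the twist-stability theorems. [cite: GrossLMS1991, §1 (p. 235)] [cite: Marcus2018, Ch. 3 Thm. 25] -/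
theorem heegnerPrime_not_dvd_discr {K : Type} [Field K] [NumberField K]
    (h2 : Module.finrank ℚ K = 2) {p : ℕ} (hp : p.Prime) (hHp : SatisfiesHeegnerHypothesis p K) :
    ¬ (p : ℤ) ∣ NumberField.discr K :=
  Literature.SatisfiesHeegnerHypothesis.not_dvd_discr h2 hHp hp (dvd_refl p)

/-! ### 1. The twin is an X9 pair (K6 predicate) -/

/-- **The Heegner twin of an X9 pair is an X9 pair** (K6 predicate `Rank1ResidualX9Defs.ClassX9`, no
semistability clause): for `W` of (census) class X9 at `p`, `K` a quadratic field in which `p` splits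
(`SatisfiesHeegnerHypothesis p K`), and a globally minimal model `Wd` of `W^{(d_K)}`
(`Cd • W.quadraticTwist d_K = Wd`): `Wd` is non-CM, good ordinary at `p ≥ 5`, with `E^K[p]` irreducible
and `ρ̄_{E^K,p}` not surjective — p4's `classX9_twist_model` with `p ∤ d_K` discharged by §0.
[cite: SilvermanAEC2009, X.5 Cor. 5.4 and VII.5 Prop. 5.1(a)] -/
theorem ClassX9.twist_of_heegner {W : WeierstrassCurve ℚ} [W.IsElliptic] [W.IsGloballyMinimal]
    {p : ℕ} [Fact p.Prime] (h : ClassX9 W p) (K : Type) [Field K] [NumberField K]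
    (h2 : Module.finrank ℚ K = 2) (hHp : SatisfiesHeegnerHypothesis p K)
    {Wd : WeierstrassCurve ℚ} [Wd.IsElliptic] [Wd.IsGloballyMinimal] (Cd : VariableChange ℚ)
    (hWd : Cd • W.quadraticTwist (NumberField.discr K : ℚ) = Wd) :
    Summit.BirchSwinnertonDyer.BirchSwinnertonDyer.Rank1Residual.ClassX9 Wd p :=
  classX9_twist_model (classX9_of_classX9_census W p h) K h2
    (heegnerPrime_not_dvd_discr h2 (Fact.out) hHp) Cd hWd

/-- **`p ∤ #E^K(ℚ)_tors`** for the Heegner twin of an X9 pair (`E^K[p]` is irreducible;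
`X9.ClassX9.padicValNat_torsionOrder`). [cite: SilvermanAEC2009, X.5 Cor. 5.4] -/
theorem ClassX9.padicValNat_torsionOrder_twist_of_heegner {W : WeierstrassCurve ℚ} [W.IsElliptic]
    [W.IsGloballyMinimal] {p : ℕ} [Fact p.Prime] (h : ClassX9 W p) (K : Type) [Field K]
    [NumberField K] (h2 : Module.finrank ℚ K = 2) (hHp : SatisfiesHeegnerHypothesis p K)
    {Wd : WeierstrassCurve ℚ} [Wd.IsElliptic] [Wd.IsGloballyMinimal] (Cd : VariableChange ℚ)
    (hWd : Cd • W.quadraticTwist (NumberField.discr K : ℚ) = Wd) :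
    padicValNat p Wd.torsionOrder = 0 :=
  Summit.BirchSwinnertonDyer.Rank1Residual.X9.ClassX9.padicValNat_torsionOrder Wd p
    (h.twist_of_heegner K h2 hHp Cd hWd)

/-! ### 2. Odd primes of `d_K` and a square-free twist parameter -/

/-- **An imaginary quadratic discriminant other than `−4`, `−8` has an odd prime factor.**
`d_K` is a fundamental discriminant (`Quadratic.isFundamentalDiscriminant_discr`): either
`d_K ≡ 1 (mod 4)` is square-free and `≠ 1` — then `|d_K| > 1` is odd and any prime factor is odd —
or `d_K = 4m` with `m ≡ 2, 3 (mod 4)` square-free — then `m = −1` iff `d_K = −4`, `m = ± 2` iff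
`d_K = ± 8`, and otherwise the odd part of `m` exceeds `1`. [cite: Marcus2018, Ch. 2 Thm. 1] -/
theorem exists_odd_prime_dvd_discr {K : Type} [Field K] [NumberField K]
    (hK : IsImaginaryQuadratic K) (h4 : NumberField.discr K ≠ -4) (h8 : NumberField.discr K ≠ -8) :
    ∃ ℓ : ℕ, ℓ.Prime ∧ ℓ ≠ 2 ∧ (ℓ : ℤ) ∣ NumberField.discr K := by
  have hneg : NumberField.discr K < 0 := hK.discr_neg
  rcases Literature.NumberTheory.QuadraticFields.Quadratic.isFundamentalDiscriminant_discr hK.1 with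
    ⟨h1, -, -⟩ | ⟨hd4, hm4, -⟩
  · -- `d_K ≡ 1 (mod 4)`: odd, and `|d_K| ≠ 1`
    have hne : (NumberField.discr K).natAbs ≠ 1 := by omega
    obtain ⟨ℓ, hℓ, hℓd⟩ := Nat.exists_prime_and_dvd hne
    refine ⟨ℓ, hℓ, ?_, Int.natCast_dvd.mpr hℓd⟩
    rintro rfl
    have h2d : ((2 : ℕ) : ℤ) ∣ NumberField.discr K := Int.natCast_dvd.mpr hℓd
    omega
  · -- `d_K = 4 m`, `m ≡ 2, 3 (mod 4)`
    set m : ℤ := NumberField.discr K / 4 with hm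
    have hdm : NumberField.discr K = 4 * m := (Int.mul_ediv_cancel' hd4).symm
    rcases hm4 with hm2 | hm3
    · -- `m = 2k` with `k` odd; `k = ±1` iff `d_K = ±8`
      set k : ℤ := m / 2 with hk
      have hmk : m = 2 * k := by omega
      have hk1 : k.natAbs ≠ 1 := by omega
      obtain ⟨ℓ, hℓ, hℓk⟩ := Nat.exists_prime_and_dvd hk1
      have hℓk' : (ℓ : ℤ) ∣ k := Int.natCast_dvd.mpr hℓk
      refine ⟨ℓ, hℓ, ?_, ?_⟩
      · rintro rfl
        have h2k : ((2 : ℕ) : ℤ) ∣ k := hℓk'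
        omega
      · rw [hdm, hmk]
        exact (hℓk'.mul_left 2).mul_left 4
    · -- `m` odd; `m = -1` iff `d_K = -4`
      have hm1 : m.natAbs ≠ 1 := by omega
      obtain ⟨ℓ, hℓ, hℓm⟩ := Nat.exists_prime_and_dvd hm1
      have hℓm' : (ℓ : ℤ) ∣ m := Int.natCast_dvd.mpr hℓm
      refine ⟨ℓ, hℓ, ?_, ?_⟩
      · rintro rfl
        have h2m : ((2 : ℕ) : ℤ) ∣ m := hℓm'
        omega
      · rw [hdm]
        exact hℓm'.mul_left 4

/-- **A square-free twist parameter through which an odd `ℓ ∣ d_K` is seen**: for a quadratic field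
`K` and an odd prime `ℓ ∣ d_K` there is a square-free `m` with `ℓ ∣ m` and `W^{(d_K)} ≅ W^{(m)}` over
`ℚ` (`m = d_K` if `d_K ≡ 1 (mod 4)`, `m = d_K / 4` otherwise: `W^{(4m)} = C • W^{(m)}`, scaling by the
square `4`). [cite: Marcus2018, Ch. 2 Thm. 1] [cite: SilvermanAEC2009, X.5 Cor. 5.4] -/
theorem exists_squarefree_twist_of_odd_prime_dvd_discr (W : WeierstrassCurve ℚ) {K : Type} [Field K]
    [NumberField K] (h2 : Module.finrank ℚ K = 2) {ℓ : ℕ} (hℓ : ℓ.Prime) (hℓ2 : ℓ ≠ 2)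
    (hℓd : (ℓ : ℤ) ∣ NumberField.discr K) :
    ∃ m : ℤ, Squarefree m ∧ (ℓ : ℤ) ∣ m ∧
      ∃ C : VariableChange ℚ, C • W.quadraticTwist (m : ℚ) =
        W.quadraticTwist (NumberField.discr K : ℚ) := by
  rcases Literature.NumberTheory.QuadraticFields.Quadratic.isFundamentalDiscriminant_discr h2 with
    ⟨-, hsq, -⟩ | ⟨hd4, -, hsq⟩
  · exact ⟨NumberField.discr K, hsq, hℓd, 1, one_smul _ _⟩
  · have hdm : NumberField.discr K = 4 * (NumberField.discr K / 4) := (Int.mul_ediv_cancel' hd4).symm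
    refine ⟨NumberField.discr K / 4, hsq, ?_, ?_⟩
    · have hℓZ : Prime (ℓ : ℤ) := Nat.prime_iff_prime_int.mp hℓ
      rw [hdm] at hℓd
      rcases hℓZ.dvd_or_dvd hℓd with h | h
      · exfalso
        have h4 : ℓ ∣ 2 * 2 := by exact_mod_cast h
        have h2' : ℓ ∣ 2 := by
          rcases (Nat.Prime.dvd_mul hℓ).mp h4 with h | h <;> exact h
        exact hℓ2 ((Nat.prime_dvd_prime_iff_eq hℓ Nat.prime_two).mp h2')
      · exact h
    · obtain ⟨C, hC⟩ :=
        W.exists_variableChange_quadraticTwist_mul_sq ((NumberField.discr K / 4 : ℤ) : ℚ) 2 two_ne_zero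
      refine ⟨C, ?_⟩
      rw [hC]
      congr 1
      rw [show (2 : ℚ) ^ 2 = ((4 : ℤ) : ℚ) by norm_num, ← Int.cast_mul, Int.ediv_mul_cancel hd4]

/-! ### 3. The twin is never semistable -/

/-- **The Heegner twin is additive at every odd prime of `d_K`, hence NOT semistable.** Let `W/ℚ` be
globally minimal elliptic, `K` a quadratic field satisfying the Heegner hypothesis for `N_E` (every
`ℓ ∣ N_E` splits in `K`), `ℓ` an odd prime dividing `d_K`, and `Wd` a globally minimal model of
`W^{(d_K)}`. Split primes are unramified, so `ℓ ∤ N_E` and `E` has GOOD reduction at `ℓ`; the twist by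
the square-free kernel `m ∋ ℓ` of `d_K` is ramified at `ℓ`, so `Wd` has ADDITIVE reduction at `ℓ`
(Silverman *AEC* VII.5.1(c); tree `X9.addv_of_smul_eq_quadraticTwist_of_dvd`) — neither good nor
multiplicative: `¬ Semistable Wd`. [cite: SilvermanAEC2009, VII.5 Prop. 5.1(c)] [cite: GrossLMS1991, §1 (p. 235)] -/
theorem not_semistable_twist_of_heegner (W : WeierstrassCurve ℚ) [W.IsElliptic] [W.IsGloballyMinimal]
    {K : Type} [Field K] [NumberField K] (h2 : Module.finrank ℚ K = 2)
    (hHN : SatisfiesHeegnerHypothesis (W.conductorNorm ℤ) K)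
    {ℓ : ℕ} (hℓ : ℓ.Prime) (hℓ2 : ℓ ≠ 2) (hℓd : (ℓ : ℤ) ∣ NumberField.discr K)
    {Wd : WeierstrassCurve ℚ} [Wd.IsElliptic] [Wd.IsGloballyMinimal] (Cd : VariableChange ℚ)
    (hWd : Cd • W.quadraticTwist (NumberField.discr K : ℚ) = Wd) : ¬ Semistable Wd := by
  haveI : Fact ℓ.Prime := ⟨hℓ⟩
  -- `ℓ ∤ N_E` (split primes are unramified), so `E` has good reduction at `ℓ`
  have hℓN : ¬ ℓ ∣ W.conductorNorm ℤ := fun h =>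
    Literature.SatisfiesHeegnerHypothesis.not_dvd_discr h2 hHN hℓ h hℓd
  have hgood : W.HasGoodReductionAtPrime ℓ := by
    by_contra hbad
    exact hℓN ((W.dvd_conductorNorm_iff_not_hasGoodReductionAtPrime ℓ).mpr hbad)
  -- the twin is a model of `W^{(m)}`, `m` square-free with `ℓ ∣ m`
  obtain ⟨m, hsq, hℓm, C₀, hC₀⟩ := exists_squarefree_twist_of_odd_prime_dvd_discr W h2 hℓ hℓ2 hℓd
  have hC' : (Cd * C₀)⁻¹ • Wd = W.quadraticTwist (m : ℚ) := by
    rw [← hWd, ← hC₀, smul_smul, smul_smul, mul_assoc, inv_mul_cancel, one_smul]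
  have haddv : Addv Wd ℓ :=
    Summit.BirchSwinnertonDyer.Rank1Residual.X9.addv_of_smul_eq_quadraticTwist_of_dvd W Wd ℓ hgood
      hℓ2 hsq hC' hℓm
  intro hs
  rcases hs ℓ hℓ with hg | hm
  · exact haddv.1 hg
  · exact haddv.2 hm

/-! ### 4. The twin satisfies the CENSUS predicate -/

/-- **The Heegner twin of an X9 pair is an X9 pair of the census** (`Rank1Residual.ClassX9 Wd p`,
rank-one clause included — indeed `Wd` is never semistable): for `W` of class X9 at `p`, `K`
imaginary quadratic with the Heegner hypothesis for `N_E` and with `p` split, `d_K ∉ {−4, −8}`, and a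
globally minimal model `Wd` of `W^{(d_K)}`. So the corner `WAllCornerX9`, the crux
`HeegnerDivisibilityX9` and every K6 item apply to the twin by name.
[cite: SilvermanAEC2009, VII.5 Prop. 5.1 and X.5 Cor. 5.4] [cite: GrossLMS1991, §1 (p. 235)] -/
theorem ClassX9.twistCensus_of_heegner {W : WeierstrassCurve ℚ} [W.IsElliptic] [W.IsGloballyMinimal]
    {p : ℕ} [Fact p.Prime] (h : ClassX9 W p) (K : Type) [Field K] [NumberField K]
    (hK : IsImaginaryQuadratic K) (hHN : SatisfiesHeegnerHypothesis (W.conductorNorm ℤ) K)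
    (hHp : SatisfiesHeegnerHypothesis p K) (h4 : NumberField.discr K ≠ -4)
    (h8 : NumberField.discr K ≠ -8)
    {Wd : WeierstrassCurve ℚ} [Wd.IsElliptic] [Wd.IsGloballyMinimal] (Cd : VariableChange ℚ)
    (hWd : Cd • W.quadraticTwist (NumberField.discr K : ℚ) = Wd) : ClassX9 Wd p := by
  obtain ⟨ℓ, hℓ, hℓ2, hℓd⟩ := exists_odd_prime_dvd_discr hK h4 h8
  have hns : ¬ Semistable Wd := not_semistable_twist_of_heegner W hK.1 hHN hℓ hℓ2 hℓd Cd hWd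
  obtain ⟨hcm, h5, hgood, hord, hirr, hnsj⟩ := h.twist_of_heegner K hK.1 hHp Cd hWd
  exact ⟨hcm, ⟨hgood, hord⟩, h5, hirr, hnsj, fun _ => hns⟩

/-- **The same under `|d_K| > 8`** (the route's "`|d_K| > B`" shape: take `B ≥ 8`).
[cite: SilvermanAEC2009, VII.5 Prop. 5.1 and X.5 Cor. 5.4] -/
theorem ClassX9.twistCensus_of_heegner_of_eight_lt {W : WeierstrassCurve ℚ} [W.IsElliptic]
    [W.IsGloballyMinimal] {p : ℕ} [Fact p.Prime] (h : ClassX9 W p) (K : Type) [Field K]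
    [NumberField K] (hK : IsImaginaryQuadratic K)
    (hHN : SatisfiesHeegnerHypothesis (W.conductorNorm ℤ) K) (hHp : SatisfiesHeegnerHypothesis p K)
    (hB : 8 < (NumberField.discr K).natAbs)
    {Wd : WeierstrassCurve ℚ} [Wd.IsElliptic] [Wd.IsGloballyMinimal] (Cd : VariableChange ℚ)
    (hWd : Cd • W.quadraticTwist (NumberField.discr K : ℚ) = Wd) : ClassX9 Wd p :=
  h.twistCensus_of_heegner K hK hHN hHp (by omega) (by omega) Cd hWd

/-! ### 5. Tamagawa numbers of the twin, `p`-adically -/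

/-- **`ord_p ∏_ℓ c_ℓ(E^K) = ord_p ∏_ℓ c_ℓ(E)` for the Heegner twin of an X9 pair** (`p ≥ 5` from the
class): Jetchev–Skinner–Wan 2017 §7.3.1 (eq:tamK) as the tree THEOREM
`padicValNat_tamagawaProduct_quadraticTwist_eq`, whose side condition on non-split bad primes is
vacuous under the Heegner hypothesis for `N_E` (every `ℓ ∣ N_E` splits in `K`). Any elliptic model
`Wd` of `W^{(d_K)}`. So the Tamagawa depth `t = ord_p ∏ c_ℓ` of crux J is the same for `E` and `E^K`.
[cite: JetchevSkinnerWan2017, §7.3.1 (eq:tamK)] -/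
theorem ClassX9.padicValNat_tamagawaProduct_twist_of_heegner {W : WeierstrassCurve ℚ} [W.IsElliptic]
    [W.IsGloballyMinimal] {p : ℕ} [Fact p.Prime] (h : ClassX9 W p) (K : Type) [Field K]
    [NumberField K] (h2 : Module.finrank ℚ K = 2)
    (hHN : SatisfiesHeegnerHypothesis (W.conductorNorm ℤ) K)
    (Wd : WeierstrassCurve ℚ) [Wd.IsElliptic]
    (hWd : ∃ C : VariableChange ℚ, C • W.quadraticTwist (NumberField.discr K : ℚ) = Wd) :
    padicValNat p Wd.tamagawaProduct = padicValNat p W.tamagawaProduct :=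
  Castella2018.TamagawaQuadratic.padicValNat_tamagawaProduct_quadraticTwist_eq W p K Wd h.2.2.1 h2
    (fun ℓ _ hℓN hns => absurd (hHN ℓ Fact.out hℓN) hns) hWd

end Literature.NumberTheory.EllipticCurves.Rank1Residual

end
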